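import Summits.QuantumFields.BalabanUV.Beta.GAN24.MultiplierMixedBondSum
import Summits.QuantumFields.BalabanUV.Beta.GAN24.StepResolventLegCharges
import Summits.QuantumFields.BalabanUV.Beta.GAN24.TransversalZeroMode

/-!
# `BalabanUV.Beta.GAN24.MixedChannelZeroMode` — binder row G-an2-4 / (CONV-C), W-slot, road «W3» (SKELETON-W3 §7.2 / §8.3 (F2)):
# THE MIXED CHANNEL OF THE BRACKET HAS ZERO FIELD–FIELD ZERO MODE, IN BOTH BOND ORIENTATIONS —
# `Σ'_{u′} Σ'_{x′} Σ'_{z′} mmRead N (K ∘ mixOfK K N M₂ κ u κ′ u′ ∘ K) x′ z′ (inl α) (inl β) = 0` and the same for `mixOfK K N M₂ κ′ u′ κ u`,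
# at EVERY first bond `u` (leaf-16's pointwise transversal form; hence leaf-02's `zmode N … = 0`), for every packed kernel `K` with decay,
# block covariance, site-free coarse-leg charges and zero `colM` bond masses — an4's dressed step kernel `unitK s_f s_m (KInvStep Lc j)`
# at blocking `Lc`, every `j`, every `d`, all units — and every (jointly block-covariant) `LocStencilFM` mixed table `M₂`
# (idle leaf seat `b2b-balaban-gan24-formalise-leaf-14`, gen 23, invitation «W3-ZB*» part 4; name provisional — the row owner may re-home it)

NOT IN PRINT; OUR BOOKKEEPING.  HONEST FRAMING (cell contract, verbatim): «discharging `BetaPertH` makes Bałaban's UV stability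
UNCONDITIONAL — a real constructive-QFT result; it is NOT the continuum limit and NOT the Clay problem.»  HONEST DEPENDENCY (verbatim):
«continuum YM on T⁴ ⇐ BetaPertH ∧ nine spine estimates (0/9 proved); BetaPertH ⇐ (D1) ∧ (D4) ∧ CAP+tail; G-an2-4 gates asym, D1 and
NE2/3/4.»  [folklore] Fubini bookkeeping (one absolutely convergent family on `Site × (Site × Site)`, `HasSum.prod_fiberwise` in two orders)
and translation re-indexing of `tsum`s over TREE objects BY NAME: an2's `SecondOrderResponse.mixOfK` / `colM` / `LocStencilFM` /
`mixOfK_translate` / `biLoc_vertexOfM_slice` / `biLoc_wsum_self_far`, an4's `KInvStep` / `colH` / `shiftK_KInvStep`, `BalabanStepJetsSucc.mmRead`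
/ `mmRead_shiftK_smul` / `comp_sandwich_shiftK`, leaf-06's `ResolventLegCharges.hasSum_sandwich_readout` + `StepResolventLegCharges` (coarse-leg
charges of the step kernel), leaf-02's `BiStencilZeroMode.zmode`, leaf-16's `TransversalZeroMode.zmode_eq_zero_of_inner_eq_zero`, and this
lineage's (S2c) `MultiplierZeroMass.hasSum_colM_unitK_KInvStep_bond` / `MultiplierMixedBondSum.hasSum_mixOfK_bond`; no estimate about
Bałaban's tables, no cited fact, no `def`, no `def … : Prop`, no wall binder; 0 sorry.  Discharges NOTHING of ROW W3-F2a ∕ F2b,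
«T2Shape» ∕ «T2SupRate» ∕ (hW, hWall); NOT «W-slot closed», NEVER «G-an2-4 closed»; NOT BetaPertH, NOT continuum, NOT Clay.

WHY (the located use).  ROW W3-F2a reads `∀ m, Zfree (b m)` for leaf-04's bracket `b m = (cE₂·Lc^{2(d+1)}) • mmRead Lc (K3OfK K♮_m Lc S♮_m M♮_m
(W2SymOfK K♮_m Lc S♮_m M♮_m 0 M₂♮_m) …) + cB • mfNeg ∘ vh₂S` (`T2RecursionAffine.unitS₂_T2Of_succ_affine`); `W2SymOfK … 0 M₂ = ½•(1 + swap) W2OfK … 0 M₂`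
carries through `−K♮ ∘ (·) ∘ K♮` (`K3OfK`'s third summand) the two MIXED terms `mixOfK K♮ Lc M₂♮ μ y ν y′`, `mixOfK K♮ Lc M₂♮ ν y′ μ y` of
`W2OfK_apply` (SKELETON-W3 §7.2: «Z(mixOfK(K̃, M̃₂)(c, c′)) = 0 (its weights are colM = K̃_mm-columns on a constant: (S2c))»).  This file
turns the lineage's pointwise bond identity `Σ'_{y′} mixOfK K N M₂ μ y ν y′ x z a b = 0` into the ZERO-MODE statements the row consumes:
* §1 `inner_tsum_firstBond_eq` — TRANSPOSITION: for a bi-table family covariant under all unit translations (`X κ (u+t) κ′ (u′+t) =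
  shiftK (−t) (X κ u κ′ u′)`), `Σ'_{u′} Σ'_x Σ'_z X κ u κ′ u′ x z a b = Σ'_v Σ'_x Σ'_z X κ v κ′ u₀ x z a b` for ALL `u, u₀` (second bond summed =
  first bond summed; pure re-indexing, no summability — the general-base-point companion of leaf-16's `inner_eq_inner_zero` ∕ leaf-02's
  `zmode_one_swap`).
* §2 `hasSum_bond_sandwich_readout`, `tsum_inner_mmRead_bond_sandwich_eq_zero` — THE SANDWICHED BOND-NULL FAMILY: `K` decaying with
  site-free coarse-leg charges `ρL`, `ρR` (leaf-06's hypotheses), `V u′` bi-localised at one centre with a constant decaying in `|N•u′ − c|₁` and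
  POINTWISE zero bond sum ⟹ `Σ'_{u′} Σ'_{x′} Σ'_{z′} mmRead N (K ∘ V u′ ∘ K) x′ z′ (inl α) (inl β) = 0`, WHATEVER the charges are.
* §3 `biLoc_mixOfK_far` (the mixed bi-vertex is bi-localised at its first bond with a constant decaying in the bond separation — the
  intermediate of an2's `vertexFamily₂_mixOfK_swap`, recorded), `mixedSandwich_translate`, **`inner_mixed_eq_zero`** (second-bond orientation),
  **`inner_mixed_swap_eq_zero`** (first-bond orientation, by §1) — generic `K`, `N ≥ 1` (`zmode` forms: one line by leaf-16's lemma).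
* §4 STEP INSTANCES `K := unitK s_f s_m (KInvStep Lc j)`, `N := Lc`, every hypothesis on `K` discharged BY NAME: `shiftK_unitK_KInvStep`,
  **`inner_mixed_unitKStep_eq_zero`**, **`inner_mixed_swap_unitKStep_eq_zero`**, `zmode_mixed_unitKStep_eq_zero`, `zmode_mixed_swap_unitKStep_eq_zero`
  — for EVERY `LocStencilFM Lc M₂ C₂ δ₂` (`δ₂ > 0`; swapped orientation: also the `hM₂` covariance shape of `BalabanStepW2.M2Of_translate`).
Still owed by F2a's assembler on this channel: only the `−K♮∘(·)∘K♮` ∕ `mmRead` ∕ `½`-linearity isolating the two mixed terms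
(`KernelWard.comp_sub_left/right`).
-/
noncomputable section

open Finset
open scoped BigOperators

namespace Summit.QuantumFields.BalabanUV.Beta.GAN24.MixedChannelZeroMode

open Literature.MathematicalPhysics.QuantumFieldTheory
open Literature.MathematicalPhysics.QuantumFieldTheory.Balaban1983to89
open Literature.MathematicalPhysics.QuantumFieldTheory.Balaban1983to89.Beta
open AffineAveraging (Site box toSite)
open B12Sec2to5 (l1 l1_nonneg)
open ExpKernelCalculus (MKer Decays BiLoc comp shiftK Zl Zl_nonneg summable_exp_shift' l1_sub_symm)
open OneStepResolventKernel (Fib wsum bound_mono biLoc_mono decays_mono)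
open OneStepKernelFamily (KInvStep decays_KInvStep shiftK_KInvStep colH vertexOfK abs_colH_le)
open SecondOrderResponse (colM vertexOfM mixOfK LocStencilFM cBi biLoc_vertexOfM_slice biLoc_wsum_self_far mixOfK_translate)
open BalabanStepJetsSucc (mmRead mmRead_inl_inl mmRead_shiftK_smul comp_sandwich_shiftK)
open Summit.QuantumFields.BalabanUV.Beta.HessKerDressedUnits (unitK unitK_apply decays_unitK)
open Summit.QuantumFields.BalabanUV.Beta.GAN24.BiStencilZeroMode (Tab zmode)
open Summit.QuantumFields.BalabanUV.Beta.GAN24.TransversalZeroMode (zmode_eq_zero_of_inner_eq_zero)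
open Summit.QuantumFields.BalabanUV.Beta.GAN24.MultiplierZeroMass (hasSum_colM_unitK_KInvStep_bond)
open Summit.QuantumFields.BalabanUV.Beta.GAN24.MultiplierMixedBondSum (hasSum_mixOfK_bond)
open Summit.QuantumFields.BalabanUV.Beta.GAN24.ResolventLegCharges (hasSum_sandwich_readout)
open Summit.QuantumFields.BalabanUV.Beta.GAN24.StepResolventLegCharges (hasSum_KInvStep_row hasSum_KInvStep_col hasSum_unitK_row
  hasSum_unitK_col)

variable {d : ℕ}

/-! ## §1 Transposition of the transversal inner sum under unit covariance -/

/-- [folklore] **TRANSPOSITION OF THE TRANSVERSAL INNER SUM.**  For a bi-table family covariant under ALL unit translations of its lattice,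
`X κ (u + t) κ′ (u′ + t) = shiftK (−t) (X κ u κ′ u′)`, the inner sum with the SECOND bond summed (at any first bond `u`) equals the inner sum
with the FIRST bond summed (at any second bond `u₀`):
`Σ'_{u′} Σ'_x Σ'_z X κ u κ′ u′ x z a b = Σ'_v Σ'_x Σ'_z X κ v κ′ u₀ x z a b`.  Pure re-indexing of `tsum`s along translations — no summability
needed (both sides equal `Σ'_w Σ'_x Σ'_z X κ 0 κ′ w x z a b`). -/
theorem inner_tsum_firstBond_eq {X : Tab d}
    (hX : ∀ (κ : Fin (d + 1)) (u : Site (d + 1)) (κ' : Fin (d + 1)) (u' t : Site (d + 1)),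
      X κ (u + t) κ' (u' + t) = shiftK (-t) (X κ u κ' u'))
    (κ κ' : Fin (d + 1)) (a b : Fib d) (u u₀ : Site (d + 1)) :
    (∑' u', ∑' x, ∑' z, X κ u κ' u' x z a b) = ∑' v, ∑' x, ∑' z, X κ v κ' u₀ x z a b := by
  -- the double kernel sum is jointly translation invariant in the two bonds
  have hF : ∀ v w t : Site (d + 1),
      (∑' x, ∑' z, X κ (v + t) κ' (w + t) x z a b) = ∑' x, ∑' z, X κ v κ' w x z a b := by
    intro v w t
    rw [hX κ v κ' w t]
    simp only [shiftK]
    rw [← (Equiv.addRight t).tsum_eq (fun x => ∑' z, X κ v κ' w (x + -t) (z + -t) a b)]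
    refine tsum_congr fun x => ?_
    rw [← (Equiv.addRight t).tsum_eq (fun z => X κ v κ' w ((Equiv.addRight t) x + -t) (z + -t) a b)]
    refine tsum_congr fun z => ?_
    simp only [Equiv.coe_addRight, add_neg_cancel_right]
  have hL : (∑' u', ∑' x, ∑' z, X κ u κ' u' x z a b) = ∑' w, ∑' x, ∑' z, X κ 0 κ' w x z a b := by
    rw [← (Equiv.addRight u).tsum_eq (fun u' => ∑' x, ∑' z, X κ u κ' u' x z a b)]
    refine tsum_congr fun w => ?_
    have h := hF 0 w u
    rw [zero_add] at h
    simpa only [Equiv.coe_addRight] using h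
  have hR : (∑' v, ∑' x, ∑' z, X κ v κ' u₀ x z a b) = ∑' w, ∑' x, ∑' z, X κ 0 κ' w x z a b := by
    rw [← (Equiv.subLeft u₀).tsum_eq (fun v => ∑' x, ∑' z, X κ v κ' u₀ x z a b)]
    refine tsum_congr fun w => ?_
    have h := hF 0 w (u₀ - w)
    rw [zero_add, add_sub_cancel] at h
    simpa only [Equiv.subLeft_apply] using h
  rw [hL, hR]

/-! ## §2 A bond-null family through the two-sided sandwich and the `mm`-read -/

section Sandwich

variable {N : ℕ} [NeZero N]

/-- [folklore] **THE SANDWICHED BOND-NULL FAMILY (double-leg `HasSum` form).**  Let `K` decay (rate `δ > 0`) with SITE-FREE coarse-leg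
charges `ρL`, `ρR` against the multiplier legs `inr α` ∕ `inr β` (as in `ResolventLegCharges.hasSum_sandwich_readout`), and let `V u′` be a
bond-indexed family of kernels, every member bi-localised at one centre `c` (rate `δv > 0`) with a constant decaying in `|N•u′ − c|₁`, whose
bond sum vanishes POINTWISE: `HasSum (u′ ↦ V u′ y w f g) 0`.  Then the bond family of double-leg read-outs
`u′ ↦ Σ'_{(x′,z′)} (K ∘ V u′ ∘ K)(N•x′, N•z′)_{(inr α, inr β)}` has `HasSum` ZERO.  Proof: by the read-out Fubini each member equals
`Σ'_{(y,w)} Σ_{f g} ρL f · V u′ y w f g · ρR g`; the family `(u′, (y, w)) ↦ Σ_{f g} ρL f · V u′ y w f g · ρR g` converges absolutely (envelope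
`A·e^{−δv|N•u′−c|₁}·e^{−δv|y−c|₁}·e^{−δv|w−c|₁}`); summed `u′`-first it vanishes fibrewise, summed `(y, w)`-first its fibres are the read-outs. -/
theorem hasSum_bond_sandwich_readout {K : MKer (d + 1) (Fib d)} {C δ : ℝ} (hK : Decays K C δ) (hδ : 0 < δ)
    (α β : Fin (d + 1)) {ρL ρR : Fib d → ℝ}
    (hrow : ∀ f y, HasSum (fun x' : Site (d + 1) => K ((N : ℤ) • x') y (Sum.inr α) f) (ρL f))
    (hcol : ∀ g w, HasSum (fun z' : Site (d + 1) => K w ((N : ℤ) • z') g (Sum.inr β)) (ρR g))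
    {V : Site (d + 1) → MKer (d + 1) (Fib d)} {Cv δv : ℝ} {c : Site (d + 1)} (hδv : 0 < δv)
    (hVb : ∀ u', BiLoc (V u') c c (Cv * Real.exp (-δv * l1 ((N : ℤ) • u' - c))) δv)
    (hV0 : ∀ y w f g, HasSum (fun u' : Site (d + 1) => V u' y w f g) 0) :
    HasSum (fun u' : Site (d + 1) => ∑' xz : Site (d + 1) × Site (d + 1),
      comp (comp K (V u')) K ((N : ℤ) • xz.1) ((N : ℤ) • xz.2) (Sum.inr α) (Sum.inr β)) 0 := by
  classical
  have hN : 1 ≤ N := Nat.one_le_iff_ne_zero.2 (NeZero.ne N)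
  have hCv : 0 ≤ Cv := by
    have h := (hVb 0).nonneg (Sum.inl 0)
    exact nonneg_of_mul_nonneg_left h (Real.exp_pos _)
  -- the read-out value of each member
  have hR : ∀ u' : Site (d + 1), ∑' xz : Site (d + 1) × Site (d + 1),
      comp (comp K (V u')) K ((N : ℤ) • xz.1) ((N : ℤ) • xz.2) (Sum.inr α) (Sum.inr β)
        = ∑' yw : Site (d + 1) × Site (d + 1), ∑ f, ∑ g, ρL f * V u' yw.1 yw.2 f g * ρR g :=
    fun u' => (hasSum_sandwich_readout hK hδ (hVb u') hδv α β hrow hcol).tsum_eq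
  simp_rw [hR]
  -- the triple family `(u′, (y, w))`
  set G : Site (d + 1) × (Site (d + 1) × Site (d + 1)) → ℝ :=
    fun q => ∑ f, ∑ g, ρL f * V q.1 q.2.1 q.2.2 f g * ρR g with hG
  set A : ℝ := (∑ f, |ρL f|) * ((∑ g, |ρR g|) * Cv) with hA
  have hGle : ∀ q, |G q| ≤ A * (Real.exp (-δv * l1 ((N : ℤ) • q.1 - c)) *
      (Real.exp (-δv * l1 (q.2.1 - c)) * Real.exp (-δv * l1 (q.2.2 - c)))) := by
    intro q
    set E : ℝ := Real.exp (-δv * l1 ((N : ℤ) • q.1 - c)) *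
      (Real.exp (-δv * l1 (q.2.1 - c)) * Real.exp (-δv * l1 (q.2.2 - c))) with hE
    have hVq : ∀ f g, |V q.1 q.2.1 q.2.2 f g| ≤ Cv * E := by
      intro f g
      have h := hVb q.1 q.2.1 q.2.2 f g
      rw [mul_add, Real.exp_add, mul_assoc] at h
      exact h
    calc |G q| ≤ ∑ f, ∑ g, |ρL f * V q.1 q.2.1 q.2.2 f g * ρR g| :=
          (Finset.abs_sum_le_sum_abs _ _).trans (Finset.sum_le_sum fun f _ => Finset.abs_sum_le_sum_abs _ _)
      _ ≤ ∑ f, ∑ g, |ρL f| * (Cv * E) * |ρR g| := by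
          refine Finset.sum_le_sum fun f _ => Finset.sum_le_sum fun g _ => ?_
          rw [abs_mul, abs_mul]
          exact mul_le_mul_of_nonneg_right (mul_le_mul_of_nonneg_left (hVq f g) (abs_nonneg _)) (abs_nonneg _)
      _ = A * E := by
          have e : ∀ f, ∑ g, |ρL f| * (Cv * E) * |ρR g| = |ρL f| * ((∑ g, |ρR g|) * Cv * E) := fun f => by
            rw [Finset.sum_mul, Finset.sum_mul, Finset.mul_sum]
            exact Finset.sum_congr rfl fun g _ => by ring
          rw [Finset.sum_congr rfl fun f _ => e f, ← Finset.sum_mul, hA]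
          ring
  have hmaj : Summable fun q : Site (d + 1) × (Site (d + 1) × Site (d + 1)) =>
      A * (Real.exp (-δv * l1 ((N : ℤ) • q.1 - c)) *
        (Real.exp (-δv * l1 (q.2.1 - c)) * Real.exp (-δv * l1 (q.2.2 - c)))) := by
    have h1 := KernelLegCharges.summable_exp_coarse (d := d) hN hδv c
    have h2 := summable_exp_shift' (D := d + 1) hδv c
    have h23 := h2.mul_of_nonneg h2 (fun _ => (Real.exp_pos _).le) (fun _ => (Real.exp_pos _).le)
    exact (h1.mul_of_nonneg h23 (fun _ => (Real.exp_pos _).le)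
      (fun _ => mul_nonneg (Real.exp_pos _).le (Real.exp_pos _).le)).mul_left A
  have hGs : Summable G := Summable.of_norm_bounded hmaj (fun q => by rw [Real.norm_eq_abs]; exact hGle q)
  -- summed `u′`-first: every fibre vanishes, so the total is `0`
  have hfib : ∀ yw : Site (d + 1) × Site (d + 1), HasSum (fun u' : Site (d + 1) => G (u', yw)) 0 := by
    intro yw
    have h := hasSum_sum (s := (Finset.univ : Finset (Fib d))) fun f _ =>
      hasSum_sum (s := (Finset.univ : Finset (Fib d))) fun g _ => ((hV0 yw.1 yw.2 f g).mul_left (ρL f)).mul_right (ρR g)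
    simp only [mul_zero, zero_mul, Finset.sum_const_zero] at h
    exact h
  have hGs' : Summable fun p : (Site (d + 1) × Site (d + 1)) × Site (d + 1) => G (p.2, p.1) := hGs.prod_symm
  have htot' : ∑' p : (Site (d + 1) × Site (d + 1)) × Site (d + 1), G (p.2, p.1) = 0 :=
    (hGs'.hasSum.prod_fiberwise hfib).unique hasSum_zero
  have htot : ∑' q, G q = 0 := by
    rw [← htot']
    exact ((Equiv.prodComm (Site (d + 1) × Site (d + 1)) (Site (d + 1))).tsum_eq G).symm
  -- summed `(y, w)`-first: the fibres are the read-out values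
  have h3 := hGs.hasSum.prod_fiberwise fun u' => (hGs.prod_factor u').hasSum
  rw [htot] at h3
  exact h3

/-- [folklore] **THE SANDWICHED BOND-NULL FAMILY (transversal inner-sum form).**  Under the hypotheses of `hasSum_bond_sandwich_readout`:
`Σ'_{u′} Σ'_{x′} Σ'_{z′} mmRead N (K ∘ V u′ ∘ K) x′ z′ (inl α) (inl β) = 0` — the iterated coarse double sum of each member is its double-leg
sum (absolute convergence from the read-out Fubini), and the bond series has `HasSum` zero. -/
theorem tsum_inner_mmRead_bond_sandwich_eq_zero {K : MKer (d + 1) (Fib d)} {C δ : ℝ} (hK : Decays K C δ) (hδ : 0 < δ)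
    (α β : Fin (d + 1)) {ρL ρR : Fib d → ℝ}
    (hrow : ∀ f y, HasSum (fun x' : Site (d + 1) => K ((N : ℤ) • x') y (Sum.inr α) f) (ρL f))
    (hcol : ∀ g w, HasSum (fun z' : Site (d + 1) => K w ((N : ℤ) • z') g (Sum.inr β)) (ρR g))
    {V : Site (d + 1) → MKer (d + 1) (Fib d)} {Cv δv : ℝ} {c : Site (d + 1)} (hδv : 0 < δv)
    (hVb : ∀ u', BiLoc (V u') c c (Cv * Real.exp (-δv * l1 ((N : ℤ) • u' - c))) δv)
    (hV0 : ∀ y w f g, HasSum (fun u' : Site (d + 1) => V u' y w f g) 0) :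
    (∑' u', ∑' x', ∑' z', mmRead N (comp (comp K (V u')) K) x' z' (Sum.inl α) (Sum.inl β)) = 0 := by
  have hpair : ∀ u' : Site (d + 1), (∑' x', ∑' z', mmRead N (comp (comp K (V u')) K) x' z' (Sum.inl α) (Sum.inl β))
      = ∑' xz : Site (d + 1) × Site (d + 1),
          comp (comp K (V u')) K ((N : ℤ) • xz.1) ((N : ℤ) • xz.2) (Sum.inr α) (Sum.inr β) := by
    intro u'
    simp only [mmRead_inl_inl]
    exact ((hasSum_sandwich_readout hK hδ (hVb u') hδv α β hrow hcol).summable.tsum_prod).symm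
  simp_rw [hpair]
  exact (hasSum_bond_sandwich_readout hK hδ α β hrow hcol hδv hVb hV0).tsum_eq

end Sandwich

/-! ## §3 The mixed channel, generic kernel -/

section Mixed

variable {N : ℕ} [NeZero N]

/-- [folklore] **THE MIXED BI-VERTEX IS BI-LOCALISED AT ITS FIRST BOND WITH A CONSTANT DECAYING IN THE BOND SEPARATION**:
`BiLoc (mixOfK K N M₂ μ y ν y′) (N•y) (N•y) (cBi · e^{−(m/8)|N•y − N•y′|₁}) (m/8)` (the field column at `(μ, y)` localises every leg; the
multiplier column at `(ν, y′)` supplies the far decay — `biLoc_vertexOfM_slice` + `biLoc_wsum_self_far`, the intermediate of an2's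
`vertexFamily₂_mixOfK_swap`, here recorded as a lemma). -/
theorem biLoc_mixOfK_far {K : MKer (d + 1) (Fib d)} {C m : ℝ} (hK : Decays K C m) (hC : 0 ≤ C)
    {M₂ : Fin (d + 1) → Site (d + 1) → Fin (d + 1) → Site (d + 1) → MKer (d + 1) (Fib d)} {C₂ : ℝ}
    (hM₂ : LocStencilFM N M₂ C₂ m) (hm : 0 < m)
    (μ : Fin (d + 1)) (y : Site (d + 1)) (ν : Fin (d + 1)) (y' : Site (d + 1)) :
    BiLoc (mixOfK K N M₂ μ y ν y') ((N : ℤ) • y) ((N : ℤ) • y)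
      (cBi d C C₂ m * Real.exp (-(m / 8) * l1 ((N : ℤ) • y - (N : ℤ) • y'))) (m / 8) := by
  have hC₂ := hM₂.nonneg
  have hZ2 := Zl_nonneg (D := d + 1) (half_pos hm)
  have hK₁ : 0 ≤ (d + 1 : ℕ) * (C * C₂ * Zl (d + 1) (m / 2)) := by positivity
  have hin : ∀ (κ : Fin (d + 1)) (u : Site (d + 1)), BiLoc (vertexOfM K N (M₂ κ u) ν y') u u
      ((d + 1 : ℕ) * (C * C₂ * Zl (d + 1) (m / 2)) * Real.exp (-(m / 2) * l1 (u - (N : ℤ) • y'))) (m / 2) := by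
    intro κ u
    have h := biLoc_vertexOfM_slice (N := N) hK hC hM₂ hm κ u ν y'
    rw [← mul_assoc] at h
    exact biLoc_mono h (by positivity) (by linarith)
  have hw : ∀ (κ : Fin (d + 1)) (u : Site (d + 1)),
      |colH K N μ y κ u| ≤ C * Real.exp (-(m / 2) * l1 (u - (N : ℤ) • y)) :=
    fun κ u => bound_mono (abs_colH_le (N := N) hK μ y κ u) hC le_rfl (by linarith) (l1_nonneg _)
  have hterm : ∀ κ : Fin (d + 1), BiLoc (wsum (colH K N μ y κ) (fun u => vertexOfM K N (M₂ κ u) ν y'))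
      ((N : ℤ) • y) ((N : ℤ) • y) (C * ((d + 1 : ℕ) * (C * C₂ * Zl (d + 1) (m / 2))) * Zl (d + 1) (m / 2 / 4)
        * Real.exp (-(m / 2 / 4) * l1 ((N : ℤ) • y - (N : ℤ) • y'))) (m / 2 / 4) :=
    fun κ => biLoc_wsum_self_far (hw κ) (hin κ) (half_pos hm) hC hK₁
  have hsum := OneStepResolventKernel.biLoc_finset_sum (Finset.univ : Finset (Fin (d + 1))) (fun κ _ => hterm κ)
  simp only [Finset.sum_const, Finset.card_univ, Fintype.card_fin, nsmul_eq_mul] at hsum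
  rw [show m / 2 / 4 = m / 8 by ring] at hsum
  have e : (d + 1 : ℕ) * (C * ((d + 1 : ℕ) * (C * C₂ * Zl (d + 1) (m / 2))) * Zl (d + 1) (m / 8)
      * Real.exp (-(m / 8) * l1 ((N : ℤ) • y - (N : ℤ) • y')))
      = cBi d C C₂ m * Real.exp (-(m / 8) * l1 ((N : ℤ) • y - (N : ℤ) • y')) := by
    unfold cBi; ring
  rw [e] at hsum
  exact hsum

/-- [folklore] **COARSE UNIT COVARIANCE OF THE SANDWICHED MIXED TERM**: for a block-covariant kernel (`shiftK (−N•t) K = K`) and a jointly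
block-covariant mixed table, `mmRead N (K ∘ mixOfK K N M₂ μ (y+t) ν (y′+t) ∘ K) = shiftK (−t) (mmRead N (K ∘ mixOfK K N M₂ μ y ν y′ ∘ K))`
(`mixOfK_translate` ⨾ `comp_sandwich_shiftK` ⨾ `mmRead_shiftK_smul`). -/
theorem mixedSandwich_translate {K : MKer (d + 1) (Fib d)} (hKs : ∀ t, shiftK (-((N : ℤ) • t)) K = K)
    {M₂ : Fin (d + 1) → Site (d + 1) → Fin (d + 1) → Site (d + 1) → MKer (d + 1) (Fib d)}
    (hM₂t : ∀ (κ : Fin (d + 1)) (u : Site (d + 1)) (ρ : Fin (d + 1)) (w t : Site (d + 1)),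
      M₂ κ (u + (N : ℤ) • t) ρ (w + t) = shiftK (-((N : ℤ) • t)) (M₂ κ u ρ w))
    (μ : Fin (d + 1)) (y : Site (d + 1)) (ν : Fin (d + 1)) (y' t : Site (d + 1)) :
    mmRead N (comp (comp K (mixOfK K N M₂ μ (y + t) ν (y' + t))) K)
      = shiftK (-t) (mmRead N (comp (comp K (mixOfK K N M₂ μ y ν y')) K)) := by
  rw [mixOfK_translate hKs hM₂t μ y ν y' t, comp_sandwich_shiftK (hKs t), mmRead_shiftK_smul]

variable {K : MKer (d + 1) (Fib d)} {C m : ℝ} {ρL ρR : Fin (d + 1) → Fib d → ℝ}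
  {M₂ : Fin (d + 1) → Site (d + 1) → Fin (d + 1) → Site (d + 1) → MKer (d + 1) (Fib d)} {C₂ : ℝ}

/-- [folklore] **THE MIXED CHANNEL HAS ZERO ff ZERO MODE — second-bond orientation, pointwise transversal form.**  For a packed kernel `K`
with `Decays K C m` (`m > 0`), zero `colM` bond masses ((S2c)) and site-free coarse-leg charges against the multiplier legs, and a
`LocStencilFM` mixed table `M₂` (rate `m`): for EVERY first bond `(κ, u)`,
`Σ'_{u′} Σ'_{x′} Σ'_{z′} mmRead N (K ∘ mixOfK K N M₂ κ u κ′ u′ ∘ K) x′ z′ (inl α) (inl β) = 0`. -/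
theorem inner_mixed_eq_zero (hK : Decays K C m) (hm : 0 < m)
    (hK0 : ∀ μ ρ w, HasSum (fun y : Site (d + 1) => colM K N μ y ρ w) 0)
    (hrow : ∀ α f y, HasSum (fun x' : Site (d + 1) => K ((N : ℤ) • x') y (Sum.inr α) f) (ρL α f))
    (hcol : ∀ β g w, HasSum (fun z' : Site (d + 1) => K w ((N : ℤ) • z') g (Sum.inr β)) (ρR β g))
    (hM₂ : LocStencilFM N M₂ C₂ m) (κ : Fin (d + 1)) (u : Site (d + 1)) (κ' α β : Fin (d + 1)) :
    (∑' u', ∑' x', ∑' z', mmRead N (comp (comp K (mixOfK K N M₂ κ u κ' u')) K) x' z' (Sum.inl α) (Sum.inl β)) = 0 := by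
  have hC : 0 ≤ C := hK.nonneg (Sum.inl 0)
  have hm8 : 0 < m / 8 := by positivity
  have hVb : ∀ u' : Site (d + 1), BiLoc (mixOfK K N M₂ κ u κ' u') ((N : ℤ) • u) ((N : ℤ) • u)
      (cBi d C C₂ m * Real.exp (-(m / 8) * l1 ((N : ℤ) • u' - (N : ℤ) • u))) (m / 8) := by
    intro u'
    have h := biLoc_mixOfK_far hK hC hM₂ hm κ u κ' u'
    rwa [l1_sub_symm] at h
  have hV0 : ∀ (y w : Site (d + 1)) (f g : Fib d),
      HasSum (fun u' : Site (d + 1) => mixOfK K N M₂ κ u κ' u' y w f g) 0 :=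
    fun y w f g => hasSum_mixOfK_bond hK hm hK0 hM₂ hm κ u κ' y w f g
  exact tsum_inner_mmRead_bond_sandwich_eq_zero hK hm α β (hrow α) (hcol β) hm8 hVb hV0

/-- [folklore] **THE MIXED CHANNEL HAS ZERO ff ZERO MODE — first-bond (swapped) orientation, pointwise transversal form.**  Under the
hypotheses of `inner_mixed_eq_zero` plus block covariance of `K` and joint block covariance of `M₂`: for EVERY first bond `(κ, u)`,
`Σ'_{u′} Σ'_{x′} Σ'_{z′} mmRead N (K ∘ mixOfK K N M₂ κ′ u′ κ u ∘ K) x′ z′ (inl α) (inl β) = 0` (the exchanged mixed term of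
`W2OfK_apply`; §1 moves the bond sum onto `mixOfK`'s multiplier slot). -/
theorem inner_mixed_swap_eq_zero (hK : Decays K C m) (hm : 0 < m) (hKs : ∀ t, shiftK (-((N : ℤ) • t)) K = K)
    (hK0 : ∀ μ ρ w, HasSum (fun y : Site (d + 1) => colM K N μ y ρ w) 0)
    (hrow : ∀ α f y, HasSum (fun x' : Site (d + 1) => K ((N : ℤ) • x') y (Sum.inr α) f) (ρL α f))
    (hcol : ∀ β g w, HasSum (fun z' : Site (d + 1) => K w ((N : ℤ) • z') g (Sum.inr β)) (ρR β g))
    (hM₂ : LocStencilFM N M₂ C₂ m)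
    (hM₂t : ∀ (κ : Fin (d + 1)) (u : Site (d + 1)) (ρ : Fin (d + 1)) (w t : Site (d + 1)),
      M₂ κ (u + (N : ℤ) • t) ρ (w + t) = shiftK (-((N : ℤ) • t)) (M₂ κ u ρ w))
    (κ : Fin (d + 1)) (u : Site (d + 1)) (κ' α β : Fin (d + 1)) :
    (∑' u', ∑' x', ∑' z', mmRead N (comp (comp K (mixOfK K N M₂ κ' u' κ u)) K) x' z' (Sum.inl α) (Sum.inl β)) = 0 := by
  have h := inner_tsum_firstBond_eq (X := fun k₁ v k₂ w => mmRead N (comp (comp K (mixOfK K N M₂ k₁ v k₂ w)) K))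
    (fun k₁ v k₂ w t => mixedSandwich_translate hKs hM₂t k₁ v k₂ w t) κ' κ (Sum.inl α) (Sum.inl β) 0 u
  rw [← h]
  exact inner_mixed_eq_zero hK hm hK0 hrow hcol hM₂ κ' 0 κ α β

end Mixed

/-! ## §4 The step instances: `K♮_j = unitK s_f s_m (KInvStep Lc j)` at blocking `Lc` -/

section Step

variable {Lc : ℕ} [NeZero Lc] (sf sm : ℝ) (j : ℕ)
  {M₂ : Fin (d + 1) → Site (d + 1) → Fin (d + 1) → Site (d + 1) → MKer (d + 1) (Fib d)} {C₂ δ₂ : ℝ}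

/-- [folklore] The dressed step kernel is block covariant at blocking `Lc` (`shiftK_KInvStep`; leg-type-constant units commute with shifts). -/
theorem shiftK_unitK_KInvStep (t : Site (d + 1)) :
    shiftK (-((Lc : ℤ) • t)) (unitK sf sm (KInvStep (d := d) Lc j)) = unitK sf sm (KInvStep (d := d) Lc j) := by
  have h : ∀ (s : Site (d + 1)) (K : MKer (d + 1) (Fib d)), shiftK s (unitK sf sm K) = unitK sf sm (shiftK s K) := by
    intro s K
    funext x y a b
    simp only [shiftK, unitK_apply]
  rw [h, shiftK_KInvStep]

/-- [folklore] **(S2c) ⇒ THE MIXED CHANNEL THROUGH THE STEP KERNEL HAS ZERO ff ZERO MODE (second-bond orientation)**: for every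
`LocStencilFM Lc M₂ C₂ δ₂` (`δ₂ > 0`), all units `s_f, s_m`, every `j`, every first bond `(κ, u)`,
`Σ'_{u′} Σ'_{x′} Σ'_{z′} mmRead Lc (K♮_j ∘ mixOfK K♮_j Lc M₂ κ u κ′ u′ ∘ K♮_j) x′ z′ (inl α) (inl β) = 0`, `K♮_j = unitK s_f s_m (KInvStep Lc j)`. -/
theorem inner_mixed_unitKStep_eq_zero (hM₂ : LocStencilFM Lc M₂ C₂ δ₂) (hδ₂ : 0 < δ₂)
    (κ : Fin (d + 1)) (u : Site (d + 1)) (κ' α β : Fin (d + 1)) :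
    (∑' u', ∑' x', ∑' z', mmRead Lc (comp (comp (unitK sf sm (KInvStep (d := d) Lc j))
      (mixOfK (unitK sf sm (KInvStep (d := d) Lc j)) Lc M₂ κ u κ' u')) (unitK sf sm (KInvStep (d := d) Lc j)))
        x' z' (Sum.inl α) (Sum.inl β)) = 0 := by
  obtain ⟨δ, C, hδ, hC, hK⟩ := decays_KInvStep (d := d) (Lc := Lc) j
  have hKu := decays_unitK (sf := sf) (sm := sm) hK
  have hm : 0 < min δ δ₂ := lt_min hδ hδ₂
  have hKu' : Decays (unitK sf sm (KInvStep (d := d) Lc j)) (max |sf| |sm| * C * max |sf| |sm|) (min δ δ₂) :=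
    decays_mono hKu (by positivity) le_rfl (min_le_left _ _)
  have hM₂' : LocStencilFM Lc M₂ C₂ (min δ δ₂) := hM₂.mono (min_le_right _ _)
  exact inner_mixed_eq_zero hKu' hm (fun μ ρ w => hasSum_colM_unitK_KInvStep_bond (Lc := Lc) sf sm j μ ρ w)
    (fun α f y => hasSum_unitK_row sf sm (hasSum_KInvStep_row (d := d) (Lc := Lc) j α f y))
    (fun β g w => hasSum_unitK_col sf sm (hasSum_KInvStep_col (d := d) (Lc := Lc) j β g w)) hM₂' κ u κ' α β

/-- [folklore] **(S2c) ⇒ THE MIXED CHANNEL THROUGH THE STEP KERNEL HAS ZERO ff ZERO MODE (first-bond ∕ swapped orientation)**, for a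
jointly block-covariant `LocStencilFM` mixed table (the `hM₂` byte shape of `mixOfK_translate` ∕ `BalabanStepW2.M2Of_translate`):
`Σ'_{u′} Σ'_{x′} Σ'_{z′} mmRead Lc (K♮_j ∘ mixOfK K♮_j Lc M₂ κ′ u′ κ u ∘ K♮_j) x′ z′ (inl α) (inl β) = 0`. -/
theorem inner_mixed_swap_unitKStep_eq_zero (hM₂ : LocStencilFM Lc M₂ C₂ δ₂) (hδ₂ : 0 < δ₂)
    (hM₂t : ∀ (κ : Fin (d + 1)) (u : Site (d + 1)) (ρ : Fin (d + 1)) (w t : Site (d + 1)),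
      M₂ κ (u + (Lc : ℤ) • t) ρ (w + t) = shiftK (-((Lc : ℤ) • t)) (M₂ κ u ρ w))
    (κ : Fin (d + 1)) (u : Site (d + 1)) (κ' α β : Fin (d + 1)) :
    (∑' u', ∑' x', ∑' z', mmRead Lc (comp (comp (unitK sf sm (KInvStep (d := d) Lc j))
      (mixOfK (unitK sf sm (KInvStep (d := d) Lc j)) Lc M₂ κ' u' κ u)) (unitK sf sm (KInvStep (d := d) Lc j)))
        x' z' (Sum.inl α) (Sum.inl β)) = 0 := by
  obtain ⟨δ, C, hδ, hC, hK⟩ := decays_KInvStep (d := d) (Lc := Lc) j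
  have hKu := decays_unitK (sf := sf) (sm := sm) hK
  have hm : 0 < min δ δ₂ := lt_min hδ hδ₂
  have hKu' : Decays (unitK sf sm (KInvStep (d := d) Lc j)) (max |sf| |sm| * C * max |sf| |sm|) (min δ δ₂) :=
    decays_mono hKu (by positivity) le_rfl (min_le_left _ _)
  have hM₂' : LocStencilFM Lc M₂ C₂ (min δ δ₂) := hM₂.mono (min_le_right _ _)
  exact inner_mixed_swap_eq_zero hKu' hm (shiftK_unitK_KInvStep sf sm j)
    (fun μ ρ w => hasSum_colM_unitK_KInvStep_bond (Lc := Lc) sf sm j μ ρ w)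
    (fun α f y => hasSum_unitK_row sf sm (hasSum_KInvStep_row (d := d) (Lc := Lc) j α f y))
    (fun β g w => hasSum_unitK_col sf sm (hasSum_KInvStep_col (d := d) (Lc := Lc) j β g w)) hM₂' hM₂t κ u κ' α β

/-- [folklore] The `zmode` form (any period `P`) of `inner_mixed_unitKStep_eq_zero`. -/
theorem zmode_mixed_unitKStep_eq_zero (P : ℕ) (hM₂ : LocStencilFM Lc M₂ C₂ δ₂) (hδ₂ : 0 < δ₂) (κ κ' α β : Fin (d + 1)) :
    zmode P (fun κ u κ' u' => mmRead Lc (comp (comp (unitK sf sm (KInvStep (d := d) Lc j))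
      (mixOfK (unitK sf sm (KInvStep (d := d) Lc j)) Lc M₂ κ u κ' u')) (unitK sf sm (KInvStep (d := d) Lc j))))
        κ κ' (Sum.inl α) (Sum.inl β) = 0 :=
  zmode_eq_zero_of_inner_eq_zero P fun u => inner_mixed_unitKStep_eq_zero sf sm j hM₂ hδ₂ κ u κ' α β

/-- [folklore] The `zmode` form (any period `P`) of `inner_mixed_swap_unitKStep_eq_zero`. -/
theorem zmode_mixed_swap_unitKStep_eq_zero (P : ℕ) (hM₂ : LocStencilFM Lc M₂ C₂ δ₂) (hδ₂ : 0 < δ₂)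
    (hM₂t : ∀ (κ : Fin (d + 1)) (u : Site (d + 1)) (ρ : Fin (d + 1)) (w t : Site (d + 1)),
      M₂ κ (u + (Lc : ℤ) • t) ρ (w + t) = shiftK (-((Lc : ℤ) • t)) (M₂ κ u ρ w))
    (κ κ' α β : Fin (d + 1)) :
    zmode P (fun κ u κ' u' => mmRead Lc (comp (comp (unitK sf sm (KInvStep (d := d) Lc j))
      (mixOfK (unitK sf sm (KInvStep (d := d) Lc j)) Lc M₂ κ' u' κ u)) (unitK sf sm (KInvStep (d := d) Lc j))))
        κ κ' (Sum.inl α) (Sum.inl β) = 0 :=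
  zmode_eq_zero_of_inner_eq_zero P fun u => inner_mixed_swap_unitKStep_eq_zero sf sm j hM₂ hδ₂ hM₂t κ u κ' α β

end Step

end Summit.QuantumFields.BalabanUV.Beta.GAN24.MixedChannelZeroMode

end
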